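import Summits.Parity.GeneralizedHardyLittlewood.Theses.GreenTaoLevelTwo
import Summits.Parity.GeneralizedHardyLittlewood.Theorems.GreenTaoLevelTwoMNTwoVerticalReductionStub
import Summits.Parity.GeneralizedHardyLittlewood.Theorems.GreenTaoLevelTwoMNTwoMnVerticalStub
import HarnessLib

/-!
# Route `GreenTaoLevelTwo`, crux `MNTwo` (stmt-Parity-21276): Möbius is orthogonal to `2`-step
# nilsequences on the Heisenberg class — the route decl, PROVED

`Summit.Parity.GeneralizedHardyLittlewood.Theses.GreenTaoLevelTwo.MNTwo` (= `MN(2)`, i.e.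
`GreenTao2010_MNAt 2 ((X.pow m).prod circle) M` for every box-comparable Def-8.1 metric `d`, every
`X` in the Heisenberg class of `H_d`, every `m` and `M`: for every `A > 0` there is `C` with
`|∑_{n ≤ N} μ(n) F(gⁿ x)| ≤ C N / log^A N` for all `N ≥ 2`, `g`, `x` and all `1`-bounded
`M`-Lipschitz `F`), by the composition of the birth skeleton `Cruxes/MNTwo/Lines/birth.lean`
(`MNTwo_of`): the by-name stubs `…MNTwoVerticalReductionStub.stub_verticalReduction`
(Green–Tao 2012a Lemma 3.7, vertical Fourier reduction) and
`…MNTwoMnVerticalStub.stub_mnVertical` (Green–Tao 2008b Thm. 1.1 for vertical characters with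
polynomial Lipschitz dependence), both landed.  `C` is ineffective (Siegel), as in print.

* `MNTwo_proof : MNTwo`.

References: B. Green, T. Tao, Ann. Inst. Fourier 58 (2008) [GreenTao2008QuadraticMobius] Thm. 1.1;
Ann. of Math. 175 (2012) [GreenTao2012Mobius] Thm. 1.1, Lemma 3.7; Ann. of Math. 171 (2010)
[GreenTao2010] Conj. 8.5 (`MN(s)`).
-/

noncomputable section

namespace Summit.Parity.GeneralizedHardyLittlewood.Theses.GreenTaoLevelTwo

/-- **Crux `MNTwo` of route `GreenTaoLevelTwo` (stmt-Parity-21276), proved**: `MN(2)` on the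
Heisenberg class of `H_d` for every compatible box-comparable metric `d` (the route decl), from the
two landed stubs of the birth skeleton — the vertical Fourier reduction `stub_verticalReduction`
(GT2012a Lemma 3.7) applied to the vertical-character case `stub_mnVertical` (GT2008b Thm. 1.1).
[cite: GreenTao2012Mobius, Thm. 1.1 and Lemma 3.7] [cite: GreenTao2008QuadraticMobius, Thm. 1.1] -/
theorem MNTwo_proof : MNTwo :=
  Summit.Parity.GeneralizedHardyLittlewood.GreenTaoLevelTwoMNTwoVerticalReductionStub.stub_verticalReduction
    Summit.Parity.GeneralizedHardyLittlewood.GreenTaoLevelTwoMNTwoMnVerticalStub.stub_mnVertical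

end Summit.Parity.GeneralizedHardyLittlewood.Theses.GreenTaoLevelTwo
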